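import Summits.BirchSwinnertonDyer.BirchSwinnertonDyer.Theorems.KimAtThreeDeepUpperPortSharedOfFineKato
import Summits.BirchSwinnertonDyer.BirchSwinnertonDyer.Theorems.KimAtThreeDeepUpperSplitGlueFineKato
import HarnessLib

/-!
# Route W2's Kato-stratum glue with (C3) DISCHARGED: cruxes 19076 / 19075 / 19077 and the leaf from
# four PUBLISHED inputs + the fine Kato package (C1) + the off-stratum items — kim3 g11's p469028 glue
# fed by THEOREM D-u (cell `bsd-addord`, seat w2-c3 gen 5; route W2 `KimAtThreeKolyvagin`, crux 19076
# `DeepUpperAtThree`, §U child 19560 `KatoKuriharaPortThreeShared`)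

HONEST FRAMING: glue theorems with DISPLAYED hypotheses (no definition, no named fact, no `sorry`);
every conclusion is a route decl BY NAME but CONDITIONAL on (C1) (and on the named off-stratum items),
so NOTHING is closed and nothing is booked; BSD is not proved by any of this.

## What

kim3 g11's `KimAtThreeDeepUpperSplitGlueFineKato` (p469028) keys the W2 cruxes on {(C1), (C3)} + the
four cite-only leaves (Sakamoto 2024 Thm. 4.4 at `3`, Gross–Zagier–Kolyvagin, Poitou–Tate, Carayol) +
the off-stratum children, with (C3) = "PORT″ on the rows WITH a `3`-anomalous bad place".  The seat's
THEOREM D-u chain (`KimAtThreeDeepUpperBadPlaceDescent` = n1011-p15's T-DER-BU U5 → `…Condition` →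
`…Clause` → `…KolyvaginPair` → `…WitnessPair` → `…PortOfZetaBody` → `…PortSharedOfFineKato`) proves
PORT″ at EVERY Kato-stratum row from (C1) + the class-wide certificate supply (w2-c3 g4 p457409), so
each `hC3` is discharged here in one line:
* `katoStratumSharedParts_of_pub_of_fineKato` — alias 19678 from PUB×4 + (C1);
* `deepUpperAtThree_of_pub_of_fineKato_of_off` — **crux 19076 from PUB×4 + (C1) + crux 19562**;
* `deepLowerAtThree_of_pub_of_fineKato_of_off` (19075 ⟸ … + 19679),
  `shallowEqDeepAtTorsionFree_of_pub_of_fineKato_of_off` (19077 ⟸ … + 19599);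
* `kimAtThreeRankZeroPUB_of_pub_of_fineKato_of_deepUpperOff_of_residualOff` — THE ROUTE'S RESIDUAL
  IN ONE KERNEL THEOREM: the leaf `N11.KimAtThreeRankZeroPUB` from PUB×4 + (C1) + crux 19562 + the
  displayed off-stratum residual (R)_off (w2-c4 g6, p463239).
So the W2 residual on the Kato stratum is (C1) ALONE (kim3 memo KIM3-W2-C1-g11: the conclusion of the
PUBLISHED fact `Kato2004.exists_eulerSystem_expStar_values` strengthened by exactly n1011's (P-EXP)
rider + R-κ — construction-shaped, displayed).

References: kim3 memos KIM3-W2-PORT-g10, KIM3-W2-C1-g11; w2-c3 memos W2C3-C2PRIME-CLASSWIDE-g4,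
W2C3-C3-LOCAL-ANALYSIS-g4; [Kato2004Asterisque] (8.1.3), Prop. 8.12, §9.4, Thm. 9.7, Thm. 6.6 (1),
Ex. 13.3; [MazurRubin2004] Thm. 3.2.4, App. A Remark A.5; [Sakamoto2024] Thm. 4.4; [Kim2025RefinedTNC]
Thm. 1.1/1.2 (announced statement; never an input).
-/

noncomputable section

-- the cell's Theorems namespace repeats the summit name by design (D-0017)
set_option linter.dupNamespace false

open scoped NumberField TensorProduct Classical
open Field Finset IsDedekindDomain NumberField WeierstrassCurve Rat.HeightOneSpectrum CongruenceSubgroup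
open Literature.NumberTheory.GaloisRepresentations Literature.NumberTheory.GaloisCohomology
open Literature.NumberTheory.GaloisRepresentations.DiscreteGaloisModule
open Literature.NumberTheory.EllipticCurves Literature.NumberTheory.EllipticCurves.ModularForms
open Literature.NumberTheory.EllipticCurves.Rank1Residual
open Literature.NumberTheory.EllipticCurves.Kato2004
open Literature.NumberTheory.EllipticCurves.Kato2004.EulerSystemValues
open Summit.BirchSwinnertonDyer.Rank1Residual.GaloisImage
open Summit.BirchSwinnertonDyer.Rank1Residual.Additive
open Summit.BirchSwinnertonDyer.BirchSwinnertonDyer.Theses.KimAtThreeKolyvagin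
open Summit.BirchSwinnertonDyer.BirchSwinnertonDyer.Theorems
open Summit.BirchSwinnertonDyer.BirchSwinnertonDyer.Theorems.KimAtThreeDeepUpperSplitGlueFineKato

namespace Summit.BirchSwinnertonDyer.BirchSwinnertonDyer.Theorems.KimAtThreeDeepUpperSplitGlueFineKatoU

/-- **Alias 19678 `KatoStratumSharedParts` from four PUBLISHED inputs BY NAME + the FINE KATO PACKAGE
(C1)** — kim3's `katoStratumSharedParts_of_pub_of_fineKato_of_anomalousRows` with (C3) discharged by
THEOREM D-u.  Conditional on (C1); nothing is booked.
[cite: Sakamoto2024, Thm. 4.4 (p. 926)] [cite: Kato2004Asterisque, (8.1.3) (p. 180), Prop. 8.12 (p. 186), §9.4 and Thm. 9.7 (pp. 188–189), Thm. 6.6 (1) (p. 163), Ex. 13.3 (pp. 224–225)]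
[cite: MazurRubin2004, Thm. 3.2.4 and App. A Remark A.5] -/
theorem katoStratumSharedParts_of_pub_of_fineKato
    (hSak : SakamotoKolyvaginThree) (hGZK : RankEqAnalyticRankLeOne)
    (hPT : PoitouTateSelmerDuality) (hlev : CarayolLevelEqConductor)
    (hC1 : ∀ (W : WeierstrassCurve ℚ) [W.IsElliptic] [W.IsGloballyMinimal]
      [ContinuousSMul ℤ_[3] (W.tateModule 3)] [Module.Free ℤ_[3] (W.tateModule 3)]
      [Module.Finite ℤ_[3] (W.tateModule 3)],
      (∀ m : ℕ, W.HasSurjectiveModNGaloisRep (3 ^ m : ℕ)) →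
      (haveI : Fact (Nat.Prime 3) := ⟨Nat.prime_three⟩; Addv W 3) →
      ¬ 3 ∣ (W.baseChange ℚ_[3]).localTamagawaNumber ℤ_[3] →
      Nat.card {Q : (W.baseChange ℚ_[3]).toAffine.Point // (3 : ℕ) • Q = 0} = 1 →
      ∀ (v₃ : HeightOneSpectrum (𝓞 ℚ)), ((3 : ℕ) : 𝓞 ℚ) ∈ v₃.asIdeal →
      ∀ {N : ℕ} [NeZero N] (P : ModularParametrizationData W N), N = W.conductorNorm ℤ →
        (∀ z ∈ P.L.lattice, ∃ w ∈ periodLattice P.f, z = P.c * w) →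
        ¬ (3 : ℤ) ∣ P.maninConstant →
        ∃ (ι : (n : ℕ) → (CyclotomicField n ℚ →+* ℂ)) (κK : ℝ)
          (Λ : ∀ (k' : ℕ) (r : Finset (HeightOneSpectrum (𝓞 ℚ))),
            H1 (tateRep W 3) (cycSubgroup 3 k' r) →ₗ[ℤ_[3]]
              ℚ_[3] ⊗[ℚ] CyclotomicField (cycLevel 3 k' r) ℚ)
          (Λfin : ∀ j : ℕ, galoisCohomology
            ((W.torsionGaloisModule (((3 : ℕ) : ℤ) ^ j * ((3 : ℕ) : ℤ))).toLocal (Sum.inr v₃)) 1 →+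
              ZMod (3 ^ (j + 1))),
          κK ≠ 0 ∧ (∃ u : ℚ, (u : ℝ) = κK ∧ padicValRat 3 u = 0) ∧
          (∀ j : ℕ, KatoExpStarFiniteLevelAt W 3 j 0 v₃ Λ (Λfin j)) ∧
          ∀ (c d a : ℤ) (A : ℕ), 0 < A → Int.gcd c (6 * 3 * A) = 1 → Int.gcd d (6 * 3 * N) = 1 →
            ∃ (z : ∀ (k' : ℕ) (r : (cyclotomicLevelsRat 3 (badPlaces c d A N)).Ideals),
                  H1 (tateRep W 3) ((cyclotomicLevelsRat 3 (badPlaces c d A N)).level k' r.1))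
              (x : ∀ (k' : ℕ) (r : (cyclotomicLevelsRat 3 (badPlaces c d A N)).Ideals),
                  CyclotomicField (cycLevel 3 k' r.1) ℚ),
              ZetaBody W 3 P.f ι κK Λ c d a A z x) :
    KatoStratumSharedParts :=
  katoStratumSharedParts_of_pub_of_fineKato_of_anomalousRows hSak hGZK hPT hlev hC1
    (fun W _ _ htow hadd hc3 ht v₃ hv₃ η _ _ _ P hN hlat hman _ =>
      KimAtThreeDeepUpperPortSharedOfFineKato.portShared_row_of_fineKato_of_certSupply hC1
        (KimAtThreeKolyvaginPortSharedCert.certSupply_of_forall_unitMinusSymbol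
          KimAtThreePortSharedC2Supply.unitMinusSymbol_classwide)
        W htow hadd hc3 ht v₃ hv₃ η P hN hlat hman)

/-- **Crux 19076 `DeepUpperAtThree` from four PUBLISHED inputs + (C1) + crux 19562
`DeepUpperAtThreeOffKatoStratum`** (w2-c4's no-stub seam p445255, kim3's glue with (C3) discharged).
Conditional; nothing is booked.
[cite: Kim2025RefinedTNC, Thm. 1.1] [cite: Sakamoto2024, Thm. 4.4 (p. 926)] [cite: Kato2004Asterisque, (8.1.3) (p. 180), Prop. 8.12 (p. 186), §9.4 and Thm. 9.7 (pp. 188–189), Thm. 6.6 (1) (p. 163), Ex. 13.3 (pp. 224–225)]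
[cite: MazurRubin2004, Thm. 5.2.12 and App. A Remark A.5] -/
theorem deepUpperAtThree_of_pub_of_fineKato_of_off
    (hSak : SakamotoKolyvaginThree) (hGZK : RankEqAnalyticRankLeOne)
    (hPT : PoitouTateSelmerDuality) (hlev : CarayolLevelEqConductor)
    (hC1 : ∀ (W : WeierstrassCurve ℚ) [W.IsElliptic] [W.IsGloballyMinimal]
      [ContinuousSMul ℤ_[3] (W.tateModule 3)] [Module.Free ℤ_[3] (W.tateModule 3)]
      [Module.Finite ℤ_[3] (W.tateModule 3)],
      (∀ m : ℕ, W.HasSurjectiveModNGaloisRep (3 ^ m : ℕ)) →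
      (haveI : Fact (Nat.Prime 3) := ⟨Nat.prime_three⟩; Addv W 3) →
      ¬ 3 ∣ (W.baseChange ℚ_[3]).localTamagawaNumber ℤ_[3] →
      Nat.card {Q : (W.baseChange ℚ_[3]).toAffine.Point // (3 : ℕ) • Q = 0} = 1 →
      ∀ (v₃ : HeightOneSpectrum (𝓞 ℚ)), ((3 : ℕ) : 𝓞 ℚ) ∈ v₃.asIdeal →
      ∀ {N : ℕ} [NeZero N] (P : ModularParametrizationData W N), N = W.conductorNorm ℤ →
        (∀ z ∈ P.L.lattice, ∃ w ∈ periodLattice P.f, z = P.c * w) →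
        ¬ (3 : ℤ) ∣ P.maninConstant →
        ∃ (ι : (n : ℕ) → (CyclotomicField n ℚ →+* ℂ)) (κK : ℝ)
          (Λ : ∀ (k' : ℕ) (r : Finset (HeightOneSpectrum (𝓞 ℚ))),
            H1 (tateRep W 3) (cycSubgroup 3 k' r) →ₗ[ℤ_[3]]
              ℚ_[3] ⊗[ℚ] CyclotomicField (cycLevel 3 k' r) ℚ)
          (Λfin : ∀ j : ℕ, galoisCohomology
            ((W.torsionGaloisModule (((3 : ℕ) : ℤ) ^ j * ((3 : ℕ) : ℤ))).toLocal (Sum.inr v₃)) 1 →+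
              ZMod (3 ^ (j + 1))),
          κK ≠ 0 ∧ (∃ u : ℚ, (u : ℝ) = κK ∧ padicValRat 3 u = 0) ∧
          (∀ j : ℕ, KatoExpStarFiniteLevelAt W 3 j 0 v₃ Λ (Λfin j)) ∧
          ∀ (c d a : ℤ) (A : ℕ), 0 < A → Int.gcd c (6 * 3 * A) = 1 → Int.gcd d (6 * 3 * N) = 1 →
            ∃ (z : ∀ (k' : ℕ) (r : (cyclotomicLevelsRat 3 (badPlaces c d A N)).Ideals),
                  H1 (tateRep W 3) ((cyclotomicLevelsRat 3 (badPlaces c d A N)).level k' r.1))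
              (x : ∀ (k' : ℕ) (r : (cyclotomicLevelsRat 3 (badPlaces c d A N)).Ideals),
                  CyclotomicField (cycLevel 3 k' r.1) ℚ),
              ZetaBody W 3 P.f ι κK Λ c d a A z x)
    (hOff : DeepUpperAtThreeOffKatoStratum) :
    Summit.BirchSwinnertonDyer.BirchSwinnertonDyer.Theses.KimAtThreeKolyvagin.DeepUpperAtThree :=
  deepUpperAtThree_of_pub_of_fineKato_of_anomalousRows_of_off hSak hGZK hPT hlev hC1
    (fun W _ _ htow hadd hc3 ht v₃ hv₃ η _ _ _ P hN hlat hman _ =>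
      KimAtThreeDeepUpperPortSharedOfFineKato.portShared_row_of_fineKato_of_certSupply hC1
        (KimAtThreeKolyvaginPortSharedCert.certSupply_of_forall_unitMinusSymbol
          KimAtThreePortSharedC2Supply.unitMinusSymbol_classwide)
        W htow hadd hc3 ht v₃ hv₃ η P hN hlat hman)
    hOff

/-- **Crux 19075 `DeepLowerAtThree` from four PUBLISHED inputs + (C1) + crux 19679
`DeepLowerAtThreeOffKatoStratum`** (glue 19680, kim3's glue with (C3) discharged).  Conditional;
nothing is booked.
[cite: Kim2025RefinedTNC, Thm. 1.1] [cite: Sakamoto2024, Thm. 4.4 (p. 926)] [cite: Kato2004Asterisque, (8.1.3) (p. 180), Prop. 8.12 (p. 186), §9.4 and Thm. 9.7 (pp. 188–189), Thm. 6.6 (1) (p. 163), Ex. 13.3 (pp. 224–225)]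
[cite: MazurRubin2004, Thm. 5.2.12 and App. A Remark A.5] -/
theorem deepLowerAtThree_of_pub_of_fineKato_of_off
    (hSak : SakamotoKolyvaginThree) (hGZK : RankEqAnalyticRankLeOne)
    (hPT : PoitouTateSelmerDuality) (hlev : CarayolLevelEqConductor)
    (hC1 : ∀ (W : WeierstrassCurve ℚ) [W.IsElliptic] [W.IsGloballyMinimal]
      [ContinuousSMul ℤ_[3] (W.tateModule 3)] [Module.Free ℤ_[3] (W.tateModule 3)]
      [Module.Finite ℤ_[3] (W.tateModule 3)],
      (∀ m : ℕ, W.HasSurjectiveModNGaloisRep (3 ^ m : ℕ)) →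
      (haveI : Fact (Nat.Prime 3) := ⟨Nat.prime_three⟩; Addv W 3) →
      ¬ 3 ∣ (W.baseChange ℚ_[3]).localTamagawaNumber ℤ_[3] →
      Nat.card {Q : (W.baseChange ℚ_[3]).toAffine.Point // (3 : ℕ) • Q = 0} = 1 →
      ∀ (v₃ : HeightOneSpectrum (𝓞 ℚ)), ((3 : ℕ) : 𝓞 ℚ) ∈ v₃.asIdeal →
      ∀ {N : ℕ} [NeZero N] (P : ModularParametrizationData W N), N = W.conductorNorm ℤ →
        (∀ z ∈ P.L.lattice, ∃ w ∈ periodLattice P.f, z = P.c * w) →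
        ¬ (3 : ℤ) ∣ P.maninConstant →
        ∃ (ι : (n : ℕ) → (CyclotomicField n ℚ →+* ℂ)) (κK : ℝ)
          (Λ : ∀ (k' : ℕ) (r : Finset (HeightOneSpectrum (𝓞 ℚ))),
            H1 (tateRep W 3) (cycSubgroup 3 k' r) →ₗ[ℤ_[3]]
              ℚ_[3] ⊗[ℚ] CyclotomicField (cycLevel 3 k' r) ℚ)
          (Λfin : ∀ j : ℕ, galoisCohomology
            ((W.torsionGaloisModule (((3 : ℕ) : ℤ) ^ j * ((3 : ℕ) : ℤ))).toLocal (Sum.inr v₃)) 1 →+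
              ZMod (3 ^ (j + 1))),
          κK ≠ 0 ∧ (∃ u : ℚ, (u : ℝ) = κK ∧ padicValRat 3 u = 0) ∧
          (∀ j : ℕ, KatoExpStarFiniteLevelAt W 3 j 0 v₃ Λ (Λfin j)) ∧
          ∀ (c d a : ℤ) (A : ℕ), 0 < A → Int.gcd c (6 * 3 * A) = 1 → Int.gcd d (6 * 3 * N) = 1 →
            ∃ (z : ∀ (k' : ℕ) (r : (cyclotomicLevelsRat 3 (badPlaces c d A N)).Ideals),
                  H1 (tateRep W 3) ((cyclotomicLevelsRat 3 (badPlaces c d A N)).level k' r.1))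
              (x : ∀ (k' : ℕ) (r : (cyclotomicLevelsRat 3 (badPlaces c d A N)).Ideals),
                  CyclotomicField (cycLevel 3 k' r.1) ℚ),
              ZetaBody W 3 P.f ι κK Λ c d a A z x)
    (hOff : DeepLowerAtThreeOffKatoStratum) :
    Summit.BirchSwinnertonDyer.BirchSwinnertonDyer.Theses.KimAtThreeKolyvagin.DeepLowerAtThree :=
  deepLowerAtThree_of_pub_of_fineKato_of_anomalousRows_of_off hSak hGZK hPT hlev hC1
    (fun W _ _ htow hadd hc3 ht v₃ hv₃ η _ _ _ P hN hlat hman _ =>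
      KimAtThreeDeepUpperPortSharedOfFineKato.portShared_row_of_fineKato_of_certSupply hC1
        (KimAtThreeKolyvaginPortSharedCert.certSupply_of_forall_unitMinusSymbol
          KimAtThreePortSharedC2Supply.unitMinusSymbol_classwide)
        W htow hadd hc3 ht v₃ hv₃ η P hN hlat hman)
    hOff

/-- **Crux 19077 `ShallowEqDeepAtTorsionFree` from four PUBLISHED inputs + (C1) + crux 19599
`ShallowEqDeepOffKatoStratum`** (w2-c4's no-stub seam, kim3's glue with (C3) discharged).
Conditional; nothing is booked.
[cite: Kim2025RefinedTNC, Thm. 1.2] [cite: Sakamoto2024, Thm. 4.4 (p. 926)] [cite: Kato2004Asterisque, (8.1.3) (p. 180), Prop. 8.12 (p. 186), §9.4 and Thm. 9.7 (pp. 188–189), Thm. 6.6 (1) (p. 163), Ex. 13.3 (pp. 224–225)]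
[cite: MazurRubin2004, Thm. 5.2.12 and App. A Remark A.5] -/
theorem shallowEqDeepAtTorsionFree_of_pub_of_fineKato_of_off
    (hSak : SakamotoKolyvaginThree) (hGZK : RankEqAnalyticRankLeOne)
    (hPT : PoitouTateSelmerDuality) (hlev : CarayolLevelEqConductor)
    (hC1 : ∀ (W : WeierstrassCurve ℚ) [W.IsElliptic] [W.IsGloballyMinimal]
      [ContinuousSMul ℤ_[3] (W.tateModule 3)] [Module.Free ℤ_[3] (W.tateModule 3)]
      [Module.Finite ℤ_[3] (W.tateModule 3)],
      (∀ m : ℕ, W.HasSurjectiveModNGaloisRep (3 ^ m : ℕ)) →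
      (haveI : Fact (Nat.Prime 3) := ⟨Nat.prime_three⟩; Addv W 3) →
      ¬ 3 ∣ (W.baseChange ℚ_[3]).localTamagawaNumber ℤ_[3] →
      Nat.card {Q : (W.baseChange ℚ_[3]).toAffine.Point // (3 : ℕ) • Q = 0} = 1 →
      ∀ (v₃ : HeightOneSpectrum (𝓞 ℚ)), ((3 : ℕ) : 𝓞 ℚ) ∈ v₃.asIdeal →
      ∀ {N : ℕ} [NeZero N] (P : ModularParametrizationData W N), N = W.conductorNorm ℤ →
        (∀ z ∈ P.L.lattice, ∃ w ∈ periodLattice P.f, z = P.c * w) →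
        ¬ (3 : ℤ) ∣ P.maninConstant →
        ∃ (ι : (n : ℕ) → (CyclotomicField n ℚ →+* ℂ)) (κK : ℝ)
          (Λ : ∀ (k' : ℕ) (r : Finset (HeightOneSpectrum (𝓞 ℚ))),
            H1 (tateRep W 3) (cycSubgroup 3 k' r) →ₗ[ℤ_[3]]
              ℚ_[3] ⊗[ℚ] CyclotomicField (cycLevel 3 k' r) ℚ)
          (Λfin : ∀ j : ℕ, galoisCohomology
            ((W.torsionGaloisModule (((3 : ℕ) : ℤ) ^ j * ((3 : ℕ) : ℤ))).toLocal (Sum.inr v₃)) 1 →+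
              ZMod (3 ^ (j + 1))),
          κK ≠ 0 ∧ (∃ u : ℚ, (u : ℝ) = κK ∧ padicValRat 3 u = 0) ∧
          (∀ j : ℕ, KatoExpStarFiniteLevelAt W 3 j 0 v₃ Λ (Λfin j)) ∧
          ∀ (c d a : ℤ) (A : ℕ), 0 < A → Int.gcd c (6 * 3 * A) = 1 → Int.gcd d (6 * 3 * N) = 1 →
            ∃ (z : ∀ (k' : ℕ) (r : (cyclotomicLevelsRat 3 (badPlaces c d A N)).Ideals),
                  H1 (tateRep W 3) ((cyclotomicLevelsRat 3 (badPlaces c d A N)).level k' r.1))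
              (x : ∀ (k' : ℕ) (r : (cyclotomicLevelsRat 3 (badPlaces c d A N)).Ideals),
                  CyclotomicField (cycLevel 3 k' r.1) ℚ),
              ZetaBody W 3 P.f ι κK Λ c d a A z x)
    (hOff : ShallowEqDeepOffKatoStratum) :
    Summit.BirchSwinnertonDyer.BirchSwinnertonDyer.Theses.KimAtThreeKolyvagin.ShallowEqDeepAtTorsionFree :=
  shallowEqDeepAtTorsionFree_of_pub_of_fineKato_of_anomalousRows_of_off hSak hGZK hPT hlev hC1
    (fun W _ _ htow hadd hc3 ht v₃ hv₃ η _ _ _ P hN hlat hman _ =>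
      KimAtThreeDeepUpperPortSharedOfFineKato.portShared_row_of_fineKato_of_certSupply hC1
        (KimAtThreeKolyvaginPortSharedCert.certSupply_of_forall_unitMinusSymbol
          KimAtThreePortSharedC2Supply.unitMinusSymbol_classwide)
        W htow hadd hc3 ht v₃ hv₃ η P hN hlat hman)
    hOff

/-- **The leaf `N11.KimAtThreeRankZeroPUB` from four PUBLISHED inputs BY NAME + (C1) + crux 19562 +
the displayed off-stratum residual (R)_off** (w2-c4 g6's seam p463239, kim3's glue with (C3)
discharged): the ROUTE'S RESIDUAL now reads {(C1), 19562, (R)_off}.  Conditional; nothing is booked.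
[cite: Kim2025RefinedTNC, Thm. 1.1 and Thm. 1.2] [cite: Kim2022StructureSelmer, Thm. 1.9 (6)]
[cite: Sakamoto2024, Thm. 4.4 (p. 926)] [cite: MazurRubin2004, Thm. 5.2.12 (i) and App. A Remark A.5] -/
theorem kimAtThreeRankZeroPUB_of_pub_of_fineKato_of_deepUpperOff_of_residualOff
    (hSak : SakamotoKolyvaginThree) (hGZK : RankEqAnalyticRankLeOne)
    (hPT : PoitouTateSelmerDuality) (hlev : CarayolLevelEqConductor)
    (hC1 : ∀ (W : WeierstrassCurve ℚ) [W.IsElliptic] [W.IsGloballyMinimal]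
      [ContinuousSMul ℤ_[3] (W.tateModule 3)] [Module.Free ℤ_[3] (W.tateModule 3)]
      [Module.Finite ℤ_[3] (W.tateModule 3)],
      (∀ m : ℕ, W.HasSurjectiveModNGaloisRep (3 ^ m : ℕ)) →
      (haveI : Fact (Nat.Prime 3) := ⟨Nat.prime_three⟩; Addv W 3) →
      ¬ 3 ∣ (W.baseChange ℚ_[3]).localTamagawaNumber ℤ_[3] →
      Nat.card {Q : (W.baseChange ℚ_[3]).toAffine.Point // (3 : ℕ) • Q = 0} = 1 →
      ∀ (v₃ : HeightOneSpectrum (𝓞 ℚ)), ((3 : ℕ) : 𝓞 ℚ) ∈ v₃.asIdeal →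
      ∀ {N : ℕ} [NeZero N] (P : ModularParametrizationData W N), N = W.conductorNorm ℤ →
        (∀ z ∈ P.L.lattice, ∃ w ∈ periodLattice P.f, z = P.c * w) →
        ¬ (3 : ℤ) ∣ P.maninConstant →
        ∃ (ι : (n : ℕ) → (CyclotomicField n ℚ →+* ℂ)) (κK : ℝ)
          (Λ : ∀ (k' : ℕ) (r : Finset (HeightOneSpectrum (𝓞 ℚ))),
            H1 (tateRep W 3) (cycSubgroup 3 k' r) →ₗ[ℤ_[3]]
              ℚ_[3] ⊗[ℚ] CyclotomicField (cycLevel 3 k' r) ℚ)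
          (Λfin : ∀ j : ℕ, galoisCohomology
            ((W.torsionGaloisModule (((3 : ℕ) : ℤ) ^ j * ((3 : ℕ) : ℤ))).toLocal (Sum.inr v₃)) 1 →+
              ZMod (3 ^ (j + 1))),
          κK ≠ 0 ∧ (∃ u : ℚ, (u : ℝ) = κK ∧ padicValRat 3 u = 0) ∧
          (∀ j : ℕ, KatoExpStarFiniteLevelAt W 3 j 0 v₃ Λ (Λfin j)) ∧
          ∀ (c d a : ℤ) (A : ℕ), 0 < A → Int.gcd c (6 * 3 * A) = 1 → Int.gcd d (6 * 3 * N) = 1 →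
            ∃ (z : ∀ (k' : ℕ) (r : (cyclotomicLevelsRat 3 (badPlaces c d A N)).Ideals),
                  H1 (tateRep W 3) ((cyclotomicLevelsRat 3 (badPlaces c d A N)).level k' r.1))
              (x : ∀ (k' : ℕ) (r : (cyclotomicLevelsRat 3 (badPlaces c d A N)).Ideals),
                  CyclotomicField (cycLevel 3 k' r.1) ℚ),
              ZetaBody W 3 P.f ι κK Λ c d a A z x)
    (hU : DeepUpperAtThreeOffKatoStratum)
    (hRoff : ∀ (W₀ : WeierstrassCurve ℚ) [W₀.IsElliptic] [W₀.IsGloballyMinimal],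
      (∀ n : ℕ, W₀.HasSurjectiveModNGaloisRep (3 ^ n : ℕ)) →
      Nat.card {Q : (W₀.baseChange ℚ_[3]).toAffine.Point // (3 : ℕ) • Q = 0} = 1 → Finite W₀.sha →
      ∀ {N : ℕ} [NeZero N], N = W₀.conductorNorm ℤ →
      ∀ (D₀ : ModularParametrizationData W₀ N),
        (∀ z ∈ D₀.L.lattice, ∃ w ∈ periodLattice D₀.f, z = D₀.c * w) →
        (∀ (W₂ : WeierstrassCurve ℚ) [W₂.IsElliptic] (D₂ : ModularParametrizationData W₂ N),
          D₂.f = D₀.f → D₀.modularDegree ≤ D₂.modularDegree) →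
        (∀ r : ℚ, ratPlusSymbol D₀.f r ≠ 0 → 0 ≤ padicValRat 3 (ratPlusSymbol D₀.f r)) →
        kuriharaVanishingOrder W₀ 3 D₀.f = 0 →
        ¬ ((haveI : Fact (Nat.Prime 3) := ⟨Nat.prime_three⟩; Addv W₀ 3) ∧
            ¬ 3 ∣ (W₀.baseChange ℚ_[3]).localTamagawaNumber ℤ_[3] ∧ ¬ (3 : ℤ) ∣ D₀.maninConstant) →
        kuriharaPartial W₀ 3 D₀.f 0 ≤
          (padicValNat 3 (Nat.card (AddCommGroup.primaryComponent W₀.sha 3)) : ℕ∞) +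
            kuriharaPartialInfty W₀ 3 D₀.f) :
    N11.KimAtThreeRankZeroPUB :=
  kimAtThreeRankZeroPUB_of_pub_of_fineKato_of_anomalousRows_of_deepUpperOff_of_residualOff hSak hGZK hPT
    hlev hC1
    (fun W _ _ htow hadd hc3 ht v₃ hv₃ η _ _ _ P hN hlat hman _ =>
      KimAtThreeDeepUpperPortSharedOfFineKato.portShared_row_of_fineKato_of_certSupply hC1
        (KimAtThreeKolyvaginPortSharedCert.certSupply_of_forall_unitMinusSymbol
          KimAtThreePortSharedC2Supply.unitMinusSymbol_classwide)
        W htow hadd hc3 ht v₃ hv₃ η P hN hlat hman)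
    hU hRoff

end Summit.BirchSwinnertonDyer.BirchSwinnertonDyer.Theorems.KimAtThreeDeepUpperSplitGlueFineKatoU

end
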